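import Mathlib
import HarnessLib
import Summits.HubbardSuperconductivity.HubbardSuperconductivity.Theorems.KLProgrammeKLRegimeTwoVolumeTowerTruncCloserS
import Summits.HubbardSuperconductivity.HubbardSuperconductivity.Theorems.KLProgrammeKLRegimeVolumeLimitV10GluedSrcPairDoorAt

/-!
# Route `KLProgramme` — crux K3, VL child `KLRegimeVolumeLimitV17F2` (stmt-HubbardSuperconductivity-20440), blueprint v5 M5 / W7-TS (v11): THE CLOSER OF
# SKELETON «cauchy» v11 — `stub_vl_nestedFramed` from `∃ t ∈ (0,1], Nonempty (TowerDataTS β U μ t)`, producer statement = the (R75f)(a) sub-diagonal read-out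
# (located «SRC-DEG2», cure (β) of plan g22 (R171); seat hubbard-kl-k3c4-p1 g15; `--supports` 20440)

`…TwoVolumeTowerTruncCloserS.gluedInner_of_towerDataTS` with the producer antecedent of skeleton v10/v11:
`∀ j, j + 1 ≤ nScales β + 1 → SourceProfilesAtLev L M (klSrcBudget P Q′ U A (j+1)) β U μ K_{n⋆} j j (j+1)`, through the re-keyed door
`…VolumeLimitV10GluedSrcPairDoorAt.stub_vl_nestedFramed_of_gluedSrcDefect_keyedAt_lev` (p621429).

* **`stub_vl_nestedFramed_of_towerDataTS_lev`** — the closer of record of skeleton «cauchy» v11.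

Proofs only; no definition.  Honest framing: a conditional closer; nothing here asserts the data, the stub, K3 or superconductivity.
-/

noncomputable section

namespace Summit.HubbardSuperconductivity.HubbardSuperconductivity.Theorems.TwoVolumeSource

set_option linter.dupNamespace false -- summit = problem name (single-conjunct summit), D-0017

open Finset Filter Topology Literature.MathematicalPhysics.QuantumLattice GrassmannAlgebra Literature.Probability.LatticeModels
  Literature.Probability.LatticeModels.BattleFederbush
open Summit.HubbardSuperconductivity.HubbardSuperconductivity.Theorems.TwoPointAssembly
open Summit.HubbardSuperconductivity.HubbardSuperconductivity.Theorems.KLRegimeSplit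
open Summit.HubbardSuperconductivity.HubbardSuperconductivity.Theorems.KLProgrammeLegKernels
open Summit.HubbardSuperconductivity.HubbardSuperconductivity.Theorems.EngineV8
open Summit.HubbardSuperconductivity.HubbardSuperconductivity.Theorems.TwoVolumeDefect

/-- **THE v11 CLOSER MODULO THE SOURCE-RESCALED TRUNCATED DATA**: the statement of `stub_vl_nestedFramed` in skeleton «cauchy» v10/v11 (producer statement =
E1's sub-diagonal read-out `SourceProfilesAtLev … j j (j+1)`) from an inhabitant of `TowerDataTS β U μ t`, some `t ∈ (0,1]`, under the regime hypotheses. [folklore: composition; cite: BenfattoGiulianiMastropietro2006, §2.7-§2.9 and §3] -/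
theorem stub_vl_nestedFramed_of_towerDataTS_lev
    (hT : (∀ (P : SplitConsts) (R : RenConsts), P.WF → R.WF2 →
      ∃ Q' : EngConsts, 0 ≤ Q'.CE ∧ ∃ c₀ : ℝ, 0 < c₀ ∧ ∀ c : ℝ, 0 < c → c ≤ c₀ → ∃ U₀ : ℝ, 0 < U₀ ∧
        ∀ μ ∈ klWindowC, ∀ U : ℝ, 0 < U → U ≤ U₀ → ∀ β : ℝ, klBetaMin ≤ β → β ≤ Real.exp (c / U ^ 2) →
          ∃ A : ℕ → ℕ → ℝ, ∃ L₁ : ℕ, ∃ M₁ : ℕ → ℕ, ∀ (L M : ℕ) [NeZero L] [NeZero M], L₁ ≤ L → M₁ L ≤ M →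
            ∀ j : ℕ, j + 1 ≤ nScales β + 1 →
              SourceProfilesAtLev L M (klSrcBudget P Q' U A (j + 1)) β U μ (klFlowFrameU L M β U μ (nScales β + 1)) j j (j + 1)) →
    ∀ (G : GeoConsts) (P : SplitConsts) (Q : EngConsts) (R : RenConsts), G.WF → P.WF → Q.WF → R.WF →
      ∃ c₅ : ℝ, 0 < c₅ ∧ ∀ c : ℝ, 0 < c → c ≤ c₅ → ∃ U₀ : ℝ, 0 < U₀ ∧
        ∀ μ ∈ klWindowC, ∀ U : ℝ, 0 < U → U ≤ U₀ → ∀ β : ℝ, klBetaMin ≤ β → β ≤ Real.exp (c / U ^ 2) →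
          ∀ K : TrigPolyC4v, klPredsV17F2.frameOK R U (nScales β) μ K →
            ∀ (Lstar : ℕ) (Mstar : ℕ → ℕ), TowerP klPredsV17F2 G P Q R β U μ K Lstar Mstar →
              ∃ t : ℝ, 0 < t ∧ t ≤ 1 ∧ Nonempty (TowerDataTS β U μ t)) :
    (∀ (P : SplitConsts) (R : RenConsts), P.WF → R.WF2 →
      ∃ Q' : EngConsts, 0 ≤ Q'.CE ∧ ∃ c₀ : ℝ, 0 < c₀ ∧ ∀ c : ℝ, 0 < c → c ≤ c₀ → ∃ U₀ : ℝ, 0 < U₀ ∧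
        ∀ μ ∈ klWindowC, ∀ U : ℝ, 0 < U → U ≤ U₀ → ∀ β : ℝ, klBetaMin ≤ β → β ≤ Real.exp (c / U ^ 2) →
          ∃ A : ℕ → ℕ → ℝ, ∃ L₁ : ℕ, ∃ M₁ : ℕ → ℕ, ∀ (L M : ℕ) [NeZero L] [NeZero M], L₁ ≤ L → M₁ L ≤ M →
            ∀ j : ℕ, j + 1 ≤ nScales β + 1 →
              SourceProfilesAtLev L M (klSrcBudget P Q' U A (j + 1)) β U μ (klFlowFrameU L M β U μ (nScales β + 1)) j j (j + 1)) →
    ∀ (G : GeoConsts) (P : SplitConsts) (Q : EngConsts) (R : RenConsts), G.WF → P.WF → Q.WF → R.WF →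
      ∃ c₅ : ℝ, 0 < c₅ ∧ ∀ c : ℝ, 0 < c → c ≤ c₅ → ∃ U₀ : ℝ, 0 < U₀ ∧
        ∀ μ ∈ klWindowC, ∀ U : ℝ, 0 < U → U ≤ U₀ → ∀ β : ℝ, klBetaMin ≤ β → β ≤ Real.exp (c / U ^ 2) →
          ∀ K : TrigPolyC4v, klPredsV17F2.frameOK R U (nScales β) μ K →
            ∀ (Lstar : ℕ) (Mstar : ℕ → ℕ), TowerP klPredsV17F2 G P Q R β U μ K Lstar Mstar →
              ∀ n : ℤ, ∃ L₀ : ℕ, ∃ ρ : ℕ → ℝ, Tendsto ρ atTop (𝓝 0) ∧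
                ∀ (L : ℕ) [NeZero L], L₀ ≤ L → ∀ (L'' : ℕ) [NeZero L''], L ∣ L'' → ∃ M₀ : ℕ, ∀ (M : ℕ) [NeZero M], M₀ ≤ M →
                  ∀ (ω : MatsubaraIdx M), matsubaraInt M ω = n → ∀ (k : TorusSite 2 L) (k'' : TorusSite 2 L''),
                    latticeMomentum L'' k'' = latticeMomentum L k →
                      ‖klSelfEnergy L M β U μ (klFlowFrameU L M β U μ (nScales β + 1)) klE0 (nScales β + 1) (ω, k) 0 -
                          klSelfEnergy L'' M β U μ (klFlowFrameU L'' M β U μ (nScales β + 1)) klE0 (nScales β + 1) (ω, k'') 0‖ ≤ ρ L := by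
  intro hSrc
  refine stub_vl_nestedFramed_of_gluedSrcDefect_keyedAt_lev (fun G P Q R hG hP hQ hR => ?_) hSrc
  obtain ⟨c₅, hc₅, hc⟩ := hT hSrc G P Q R hG hP hQ hR
  refine ⟨c₅, hc₅, fun c hc0 hcc => ?_⟩
  obtain ⟨U₀, hU₀, hU⟩ := hc c hc0 hcc
  refine ⟨U₀, hU₀, fun μ hμ U hU0 hUU β hβmin hβmax K hK Lstar Mstar hTP => ?_⟩
  obtain ⟨t, ht0, ht1, ⟨D⟩⟩ := hU μ hμ U hU0 hUU β hβmin hβmax K hK Lstar Mstar hTP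
  exact gluedInner_of_towerDataTS β U μ (KLRegimeSplit.pos_of_klBetaMin_le hβmin) ht0 ht1 D

end Summit.HubbardSuperconductivity.HubbardSuperconductivity.Theorems.TwoVolumeSource

end
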